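import Summits.NavierStokesRegularity.NavierStokesRegularity.Theses.AxisymmetricExtremality
import Literature.Analysis.FluidPDE.AxisymmetricEuler
import Literature.Analysis.FluidPDE.KatoMaximalTime

/-!
# Strategist census s20-g27 — typed companions (crux `AxisymmetricKatoGlobal`, stmt-NavierStokesRegularity-15453)

Kernel-checked signatures quoted in `STRATEGY-CENSUS-s20.md` (family `s`, gen 27, independent):

* `NoAxisymMinimalDatum` (W0) — the exact residual of the route's `closes`: what `closes` actually
  consumes of the crux.  `noAxisymMinimalDatum_of_crux` (crux ⇒ W0) and `closes_of_W0`
  (MinimalDatumPFold → PFoldToAxisymmetric → W0 → NavierStokesRegularity) are PROVED (pure logic),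
  so W0 is a genuinely weaker-or-equal consumable replacement; the census explains why it has no tool.
* `SwirlBoundedNearAxis` (piece A) and `ContinuationOfBoundedSwirl` (piece K) — the best typed
  "a-priori estimate ∧ conditional criterion" split; A is provable with classical tools (far-field
  bound + parabolic maximum principle for `Γ = swirl`), so K ≡ crux over the tree: the split collapses.
* `AxisymKatoGlobalQuantitative` (S⁺) — the quantitative strengthening; no added rigidity.

Nothing here is filed as an item; no `sorry`.
-/

namespace Summit.NavierStokesRegularity.NavierStokesRegularity.Cruxes.AxisymmetricKatoGlobal.StrategistS20g27

open MeasureTheory Set Function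
open Literature.Analysis.FluidPDE Literature.Analysis.FunctionSpaces
open scoped ENNReal

set_option linter.dupNamespace false

local notation "ℝ³" => EuclideanSpace ℝ (Fin 3)
local notation "ℂ³" => EuclideanSpace ℂ (Fin 3)

/-- The route's written-out axisymmetry clause (`IsAxisymmetric u₀` unfolded, `Iff.rfl`). -/
def AxisymWritten (u₀ : ℝ³ → ℝ³) : Prop :=
  ∀ (θ : ℝ) (x : ℝ³), u₀ (WithLp.toLp 2 ![Real.cos θ * x 0 - Real.sin θ * x 1,
    Real.sin θ * x 0 + Real.cos θ * x 1, x 2]) = WithLp.toLp 2 ![Real.cos θ * u₀ x 0 - Real.sin θ * u₀ x 1,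
    Real.sin θ * u₀ x 0 + Real.cos θ * u₀ x 1, u₀ x 2]

theorem axisymWritten_iff (u₀ : ℝ³ → ℝ³) : AxisymWritten u₀ ↔ IsAxisymmetric u₀ := Iff.rfl

/-- **W0** — no axisymmetric Rusin–Šverák minimal blow-up datum, at any viscosity. -/
def NoAxisymMinimalDatum : Prop :=
  ∀ ν : ℝ, 0 < ν → ¬ ∃ (u₀ : ℝ³ → ℝ³) (g : HomSobolev ℝ³ ℂ³ (1 / 2 : ℝ)),
    IsMinimalBlowupDatum ν u₀ g ∧ AxisymWritten u₀

/-- crux ⇒ W0 (W0 is weaker-or-equal). -/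
theorem noAxisymMinimalDatum_of_crux
    (h : Theses.AxisymmetricExtremality.AxisymmetricKatoGlobal) : NoAxisymMinimalDatum := by
  rintro ν hν ⟨u₀, g, ⟨hL3, hrep, hdiv, -, hnot⟩, hax⟩
  exact hnot (h ν hν u₀ g hL3 hrep hdiv hax)

/-- W0 suffices for the route: the deciding theorem with the crux replaced by W0 (same logic as
`Theses.AxisymmetricExtremality.closes`). -/
theorem closes_of_W0 (h₂ : Theses.AxisymmetricExtremality.MinimalDatumPFold)
    (h₄ : Theses.AxisymmetricExtremality.PFoldToAxisymmetric) (hW : NoAxisymMinimalDatum) :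
    _root_.NavierStokesRegularity := by
  show Literature.NS.NavierStokesExistenceSmoothR3
  intro ν hν u₀ hsm hdiv hdec
  by_contra hno
  obtain ⟨u₁, g, hmin, hax⟩ := h₄ ν hν (h₂ ν hν ⟨u₀, hsm, hdiv, hdec, hno⟩)
  exact hW ν hν ⟨u₁, g, hmin, hax⟩

/-- **Piece A** (a-priori, classical): along an axisymmetric Kato solution smooth on `(0,T)`, the
swirl `Γ = swirl (u t)` stays BOUNDED near the axis on `[t₀, T)` for every `0 < t₀ < T`
(far-field bound of Kato solutions near the final time + the parabolic maximum principle for the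
`Γ`-equation on a large ball; no smallness). -/
def SwirlBoundedNearAxis : Prop :=
  ∀ ν : ℝ, 0 < ν → ∀ T : ℝ, 0 < T → ∀ (u₀ : ℝ³ → ℝ³) (u : ℝ → ℝ³ → ℝ³),
    IsKatoSolutionOn T ν u₀ u → ContDiffOn ℝ (⊤ : ℕ∞) (uncurry u) (Ioo 0 T ×ˢ univ) →
    (∀ t ∈ Ioo 0 T, IsAxisymmetric (u t)) →
    ∀ t₀ ∈ Ioo 0 T, ∃ C δ₀ : ℝ, 0 < δ₀ ∧
      ∀ t ∈ Ico t₀ T, ∀ x : ℝ³, cylRadius x ≤ δ₀ → |swirl (u t) x| ≤ C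

/-- **Piece K** (continuation criterion): bounded swirl near the axis on `[t₀, T)` ⇒ the solution
is bounded up to `T` (hence continues past `T`).  Over the tree (A provable) this is the crux again:
for Schwartz data `Γ₀ ∈ L^∞` persists, so "bounded `Γ` ⇒ regular" IS axisymmetric-with-swirl
regularity; known only under smallness / `|u| ≤ C/r` / log-decay of `Γ` at the axis. -/
def ContinuationOfBoundedSwirl : Prop :=
  ∀ ν : ℝ, 0 < ν → ∀ T : ℝ, 0 < T → ∀ (u₀ : ℝ³ → ℝ³) (u : ℝ → ℝ³ → ℝ³),
    IsKatoSolutionOn T ν u₀ u → ContDiffOn ℝ (⊤ : ℕ∞) (uncurry u) (Ioo 0 T ×ˢ univ) →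
    (∀ t ∈ Ioo 0 T, IsAxisymmetric (u t)) →
    ∀ t₀ ∈ Ioo 0 T, (∃ C δ₀ : ℝ, 0 < δ₀ ∧
      ∀ t ∈ Ico t₀ T, ∀ x : ℝ³, cylRadius x ≤ δ₀ → |swirl (u t) x| ≤ C) →
    eLpNorm (uncurry u) ∞ (volume.restrict (Ioo t₀ T ×ˢ (univ : Set ℝ³))) < ∞

/-- **S⁺** (quantitative strengthening): a global Kato solution WITH an a-priori bound of the
critical norm by a function of the datum's size.  Strictly stronger in form; no induction /
compactness handle is gained (the bound function is exactly what no method produces). -/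
def AxisymKatoGlobalQuantitative : Prop :=
  ∃ F : ℝ → ℝ, ∀ ν : ℝ, 0 < ν → ∀ (u₀ : ℝ³ → ℝ³) (g : HomSobolev ℝ³ ℂ³ (1 / 2 : ℝ)),
    MemLp u₀ 3 volume → g.Represents (Literature.Analysis.FunctionSpaces.EuclideanSpace.complexify ∘ u₀) →
    IsWeaklyDivFree u₀ → AxisymWritten u₀ →
    ∃ u : ℝ → ℝ³ → ℝ³, (∀ T : ℝ, 0 < T → IsKatoSolutionOn T ν u₀ u) ∧
      ∀ t : ℝ, 0 ≤ t → eLpNorm (u t) 3 volume ≤ ENNReal.ofReal (F ((eLpNorm u₀ 3 volume).toReal / ν) * ν)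

end Summit.NavierStokesRegularity.NavierStokesRegularity.Cruxes.AxisymmetricKatoGlobal.StrategistS20g27
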